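import Summits.HodgeConjecture.HodgeConjecture.Theorems.MarkmanPartnerTransportPicardThreeK3SquaresRMLociSquares
import Summits.HodgeConjecture.HodgeConjecture.Theorems.MarkmanPartnerTransportPartnerTransport
import HarnessLib

/-!
# Route MarkmanPartnerTransport · target `K3Sq2TypeHodge` via crux #4 — HC⁴(X) for every marked
# K3^[2]-type fourfold X whose K3 PARTNER lies on the ζ₉ or ζ₁₁ real-multiplication Hodge locus

Cell hodge-nonav; prover seat hodge-nonav-19652-p1 (gen 20); `--supports stmt-HodgeConjecture-19652`, helper.
The X-side face of the gen-20 capstone `…RMLociSquares` (HC⁴(S ⊗ S) for every K3 surface `S` whose period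
lies on the ζ₉ ∕ ζ₁₁ locus), through the route's support `PartnerTransport` in its proved explicit form
`PartnerLattice.partnerTransport_explicit` (Beauville's marked Hilbert square, blow-up descent, Markman's
algebraic lift, Voisin cup). CONDITIONAL on {`Buskin2019_hodgeIsometry_algebraic`,
`Huybrechts_K3_marking_exists`, the ∀-member van Geemen–Schütt fact, `Beauville1983_hilbertSquare_markedIncidence`,
`Beauville1983_hilbertSquare_blowupDiagonal_surjection`, `Markman2024_rationalHodgeIsometry_lift_algebraic_marked`,
`Voisin2003_cupProduct_algebraicClasses`}; credits nothing; nothing here says HC is proved; rung F-H1 not moved.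

* **`exists_zeta9Locus_hodgeConjectureFor_of_partner`** — THERE IS a ζ₉ datum `(g, y₀, θ)` such that EVERY
  marked smooth projective K3^[2]-type fourfold `(X, φ, P, z)` with a K3 partner `(S, η, p, x; g')`
  (`Partner[X, φ, S, η, g']`: `g' : H²(S) → H²(X)` rational, type-preserving, isometric on the transcendental
  classes) whose period lies on the ζ₉ locus (`θ_ℂ(σx) = 2cos(2π/9)·σx` for a rational isometry `σ` of `Λ_ℚ`)
  satisfies `HodgeConjectureFor 4 X` — partnered K3^[2]-type fourfolds of Picard number `11`, `14`, `17`
  (`ρ(X) = ρ(S) + 1`).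
* **`hodgeConjectureFor_of_partner_zeta11Locus`** — the same on the ζ₁₁ locus, for every ζ₁₁ datum:
  `ρ(X) ∈ {3, 8, 13}` (the `ρ(X) = 3` case is cell (3,5) of crux #5, gen 11 ∕ 20241-p1's «ZETA11-X»;
  `ρ(X) = 8` is new).

No definition, no sorry, no new named fact. References: van Geemen–Schütt, Forum Math. Sigma 13 (2025) e2,
Thm. 1.1 (9), (11), §4.8; Markman, J. reine angew. Math. (2024) §1.1 Thm. 1.1 and Thm. 1.4; Beauville, J.
Differential Geom. 18 (1983) §6; Buskin, J. reine angew. Math. 755 (2019), Thm. 1.1.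
-/

noncomputable section

set_option linter.dupNamespace false

open scoped Matrix
open Module CategoryTheory MonoidalCategory Polynomial
open Literature.AlgebraicTopology.SingularHomology Literature.Geometry.Kaehler
open Literature.AlgebraicGeometry Literature.AlgebraicGeometry.Motives Literature.AlgebraicGeometry.HodgeTheory
open Literature.AlgebraicGeometry.Hyperkaehler Literature.AlgebraicGeometry.Surfaces
open Literature.AlgebraicGeometry.HilbertScheme
open Summit.HodgeConjecture.HodgeConjecture.Theorems.NikulinTwinTransport
open Summit.HodgeConjecture.HodgeConjecture.Theorems.MarkmanPartnerTransport.RMTypeDescent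
open Summit.HodgeConjecture.HodgeConjecture.Theorems.MarkmanPartnerTransport.RMTypeOrbit

namespace Summit.HodgeConjecture.HodgeConjecture.Theorems.MarkmanPartnerTransport.PartnerLattice

/-- `MarkedK3Sq[X, φ, P, z]`: VERBATIM the `let MarkedK3Sq := …` binder of the route declarations of
MarkmanPartnerTransport (clauses (m1)–(m6)). Local notation only. -/
local notation3 (prettyPrint := false) "MarkedK3Sq[" X ", " φ ", " P ", " z "]" =>
  (((IsIntegralClass P ∧ ∀ Q : complexBetti X (2 * 4), IsIntegralClass Q → ∃ n : ℤ, Q = n • P) ∧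
    (∀ c : complexBetti X 2, IsIntegralClass c ↔ ∃ v : K3HilbertIndex → ℤ, φ c = fun i => (v i : ℂ)) ∧
    (∀ a : complexBetti X 2, cupPowTwo a 4 = ((3 : ℂ) * (k3HilbertForm 2 (φ a) (φ a)) ^ 2) • P) ∧
    (IsOfHodgeType 4 X 2 2 0 (LinearEquiv.symm φ z) ∧
      ∀ τ : complexBetti X 2, IsOfHodgeType 4 X 2 2 0 τ → ∃ t : ℂ, τ = t • LinearEquiv.symm φ z) ∧
    (∀ c : complexBetti X 2, IsOfHodgeType 4 X 2 1 1 c ↔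
      (k3HilbertForm 2 (φ c) z = 0 ∧ k3HilbertForm 2 (φ c) (star z) = 0)) ∧
    (k3HilbertForm 2 z z = 0 ∧ 0 < (k3HilbertForm 2 (star z) z).re)))

/-- `MarkedK3[S, η, p, x]`: VERBATIM the `let MarkedK3 := …` binder of the route declarations (`p ≠ 0`, the six
marking clauses, the projective period point). Local notation only. -/
local notation3 (prettyPrint := false) "MarkedK3[" S ", " η ", " p ", " x "]" =>
  (p ≠ 0 ∧ (IsIntegralClass p ∧
    (∀ q : complexBetti S (2 * 2), IsIntegralClass q → ∃ n : ℤ, q = n • p) ∧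
    (∀ c : complexBetti S (2 * 1), IsIntegralClass c ↔ ∃ v : K3Index → ℤ, η c = fun i => (v i : ℂ)) ∧
    (∀ a b : complexBetti S (2 * 1),
      cupProduct (rfl : 2 * 1 + 2 * 1 = 2 * 2) a b = k3Form (η a) (η b) • p) ∧
    IsOfHodgeType 2 S (2 * 1) 2 0 (LinearEquiv.symm η x) ∧
    (∀ τ : complexBetti S (2 * 1), IsOfHodgeType 2 S (2 * 1) 2 0 τ →
      ∃ t : ℂ, τ = t • LinearEquiv.symm η x)) ∧
    (k3Form x x = 0 ∧ 0 < (k3Form (star x) x).re ∧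
      ∃ u : K3Index → ℤ, k3Form (fun i => (u i : ℂ)) x = 0 ∧ 0 < ∑ i, ∑ j, u i * k3Gram i j * u j))

/-- `Partner[X, φ, S, η, g]`: clauses (g1), (g2), (g5) of the route's `IsK3Partner` datum — `g : H²(S) → H²(X)`
rational, type-preserving, isometric on cup-transcendental classes (the clauses `partnerTransport_explicit` uses).
Local notation only. -/
local notation3 (prettyPrint := false) "Partner[" X ", " φ ", " S ", " η ", " g "]" =>
  ((∀ a, IsRationalClass a → IsRationalClass (g a)) ∧
    (∀ (i j : ℕ) a, IsOfHodgeType 2 S (2 * 1) i j a → IsOfHodgeType 4 X 2 i j (g a)) ∧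
    (∀ a b, (∀ d ∈ algebraicClasses S 1, cupProduct (rfl : 2 * 1 + 2 * 1 = 2 * 2) a d = 0) →
      (∀ d ∈ algebraicClasses S 1, cupProduct (rfl : 2 * 1 + 2 * 1 = 2 * 2) b d = 0) →
      k3HilbertForm 2 (φ (g a)) (φ (g b)) = k3Form (η a) (η b)))

/-- `Zeta9Model[g, y₀, θ]`: VERBATIM the datum conjuncts of the named fact
`VanGeemenSchuett2025_zeta9_cycleOnOpenPeriodSet` (as in `…Zeta9Type`). Local notation only. -/
local notation3 (prettyPrint := false) "Zeta9Model[" g ", " y₀ ", " θ "]" =>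
  ((∀ a b : K3Index → ℂ, k3Form (g a) (g b) = k3Form a b) ∧
    (∀ v : K3Index → ℤ, ∃ w : K3Index → ℤ,
      g (fun i => ((v i : ℤ) : ℂ)) = fun i => ((w i : ℤ) : ℂ)) ∧
    g ^ 9 = 1 ∧
    Module.finrank ℂ (LinearMap.ker (g ^ 3 - 1)) = 10 ∧
    k3Form y₀ y₀ = 0 ∧ 0 < (k3Form (star y₀) y₀).re ∧
    g y₀ = Complex.exp (2 * Real.pi * Complex.I / 9) • y₀ ∧
    (∀ y : K3Index → ℂ, thetaC θ y =
      (1 / 3 : ℂ) • ((2 : ℂ) • g y + (2 : ℂ) • (g ^ 8) y - (g ^ 2) y - (g ^ 4) y - (g ^ 5) y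
        - (g ^ 7) y)))

/-- `Zeta11Model[g, u₁, u₂, y₀, θ]`: VERBATIM the antecedents of the named fact
`VanGeemenSchuett2025_OguisoZhang2011_zeta11_cycleOnOpenPeriodSet` (as in `…PicardThreeK3SquaresZeta11Type`).
Local notation only. -/
local notation3 (prettyPrint := false) "Zeta11Model[" g ", " u₁ ", " u₂ ", " y₀ ", " θ "]" =>
  ((∀ a b : K3Index → ℂ, k3Form (g a) (g b) = k3Form a b) ∧
    (∀ v : K3Index → ℤ, ∃ w : K3Index → ℤ,
      g (fun i => ((v i : ℤ) : ℂ)) = fun i => ((w i : ℤ) : ℂ)) ∧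
    g ^ 11 = 1 ∧
    g (fun i => ((u₁ i : ℤ) : ℂ)) = (fun i => ((u₁ i : ℤ) : ℂ)) ∧
    g (fun i => ((u₂ i : ℤ) : ℂ)) = (fun i => ((u₂ i : ℤ) : ℂ)) ∧
    k3Form (fun i => ((u₁ i : ℤ) : ℂ)) (fun i => ((u₁ i : ℤ) : ℂ)) = 0 ∧
    k3Form (fun i => ((u₂ i : ℤ) : ℂ)) (fun i => ((u₂ i : ℤ) : ℂ)) = 0 ∧
    k3Form (fun i => ((u₁ i : ℤ) : ℂ)) (fun i => ((u₂ i : ℤ) : ℂ)) = 1 ∧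
    (∀ v : K3Index → ℤ, g (fun i => ((v i : ℤ) : ℂ)) = (fun i => ((v i : ℤ) : ℂ)) →
      ∃ m n : ℤ, v = m • u₁ + n • u₂) ∧
    k3Form y₀ y₀ = 0 ∧ 0 < (k3Form (star y₀) y₀).re ∧
    g y₀ = Complex.exp (2 * Real.pi * Complex.I / 11) • y₀ ∧
    (∀ y : K3Index → ℂ, thetaC θ y =
      g y + (g ^ 10) y - (2 * k3Form y (fun i => ((u₂ i : ℤ) : ℂ))) • (fun i => ((u₁ i : ℤ) : ℂ))
        - (2 * k3Form y (fun i => ((u₁ i : ℤ) : ℂ))) • (fun i => ((u₂ i : ℤ) : ℂ))))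

variable {X S : SchemeOver ℂ} {φ : complexBetti X 2 ≃ₗ[ℂ] (K3HilbertIndex → ℂ)} {P : complexBetti X (2 * 4)}
  {z : K3HilbertIndex → ℂ} {η : complexBetti S (2 * 1) ≃ₗ[ℂ] (K3Index → ℂ)} {p : complexBetti S (2 * 2)}
  {x : K3Index → ℂ}

/-- **HC⁴(X) for every marked K3^[2]-type fourfold whose K3 partner lies on the ζ₉ locus.** THERE IS a ζ₉
datum `(g, y₀, θ)` such that for every marked smooth projective K3^[2]-type fourfold `(X, φ, P, z)`, every
marked projective K3 partner `(S, η, p, x)` with partner map `g'` (`Partner[X, φ, S, η, g']`) and every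
rational isometry `σ` of `Λ_ℚ` with `θ_ℂ(σx) = 2cos(2π/9)·σx`: `HodgeConjectureFor 4 X`
(`RMTypeOrbit.exists_zeta9Locus_hodgeConjectureFor_square` + `partnerTransport_explicit`). CONDITIONAL on the
seven displayed facts; credits nothing; HC is NOT proved here. [cite: GeemenSchutt2023, Thm. 1.1 (9) and §4.8]
[cite: Markman2024, §1.1 Thm. 1.1 and Thm. 1.4] [cite: Beauville1983, §6 (e)–(f), Prop. 6] [cite: Buskin2019, Thm. 1.1] -/
theorem exists_zeta9Locus_hodgeConjectureFor_of_partner (hB : Buskin2019_hodgeIsometry_algebraic)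
    (hmark : Huybrechts_K3_marking_exists) (hV : VanGeemenSchuett2025_zeta9_cycleOnOpenPeriodSet_everyMember)
    (hBI : Beauville1983_hilbertSquare_markedIncidence) (hBea : Beauville1983_hilbertSquare_blowupDiagonal_surjection)
    (hMk : Markman2024_rationalHodgeIsometry_lift_algebraic_marked) (hcup : Voisin2003_cupProduct_algebraicClasses) :
    ∃ (g : Module.End ℂ (K3Index → ℂ)) (y₀ : K3Index → ℂ) (θ : Matrix K3Index K3Index ℚ),
      Zeta9Model[g, y₀, θ] ∧
      ∀ (X : SchemeOver ℂ) (_hX : IsSmoothProjective 4 X) (_hK : IsOfK3HilbertSquareType X)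
        (φ : complexBetti X 2 ≃ₗ[ℂ] (K3HilbertIndex → ℂ)) (P : complexBetti X (2 * 4)) (z : K3HilbertIndex → ℂ)
        (_hM : MarkedK3Sq[X, φ, P, z])
        (S : SchemeOver ℂ) (_hS : IsK3Surface S) (η : complexBetti S (2 * 1) ≃ₗ[ℂ] (K3Index → ℂ))
        (p : complexBetti S (2 * 2)) (x : K3Index → ℂ) (_hMS : MarkedK3[S, η, p, x])
        (g' : complexBetti S (2 * 1) →ₗ[ℂ] complexBetti X 2) (_hg : Partner[X, φ, S, η, g'])
        (σ : Module.End ℂ (K3Index → ℂ)) (_hσ : ∀ a b, k3Form (σ a) (σ b) = k3Form a b)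
        (_hσrat : ∀ v : K3Index → ℤ, ∃ w : K3Index → ℚ, σ (fun i => (v i : ℂ)) = fun i => (w i : ℂ))
        (_heig : thetaC θ (σ x) = (((2 * Real.cos (2 * Real.pi / 9) : ℝ)) : ℂ) • σ x),
        HodgeConjectureFor 4 X := by
  obtain ⟨g, y₀, θ, hZ, hsq⟩ := exists_zeta9Locus_hodgeConjectureFor_square hB hmark hV
  refine ⟨g, y₀, θ, hZ, ?_⟩
  intro X hX hK φ P z hM S hS η p x hMS g' hg σ hσ hσrat heig
  have hSS := hsq S hS η p x hMS σ hσ hσrat heig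
  obtain ⟨_, hmk, hxx, hxpos, hu⟩ := hMS
  obtain ⟨hg1, hg2, hg5⟩ := hg
  exact partnerTransport_explicit hBI hBea hMk hcup hX hK hM hS hmk hxx hxpos hu hg1 hg2 hg5 hSS

/-- **HC⁴(X) for every marked K3^[2]-type fourfold whose K3 partner lies on the ζ₁₁ locus**, for every ζ₁₁
datum `(g, u₁, u₂, y₀, θ)`: marked `(X, φ, P, z)`, partner `(S, η, p, x; g')`, rational isometry `σ` with
`θ_ℂ(σx) = 2cos(2π/11)·σx` ⟹ `HodgeConjectureFor 4 X` (`RMTypeOrbit.hodgeConjectureFor_square_of_zeta11Locus`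
+ `partnerTransport_explicit`). `ρ(X) = ρ(S) + 1 ∈ {3, 8, 13}`. CONDITIONAL on the seven displayed facts;
credits nothing; HC is NOT proved here. [cite: GeemenSchutt2023, Thm. 1.1 (11) and §4.8]
[cite: OguisoZhang2011K3Order11, Thm. 1.5 (3)] [cite: Markman2024, §1.1 Thm. 1.1 and Thm. 1.4]
[cite: Beauville1983, §6 (e)–(f), Prop. 6] [cite: Buskin2019, Thm. 1.1] -/
theorem hodgeConjectureFor_of_partner_zeta11Locus (hB : Buskin2019_hodgeIsometry_algebraic)
    (hmark : Huybrechts_K3_marking_exists)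
    (hV : VanGeemenSchuett2025_OguisoZhang2011_zeta11_cycleOnOpenPeriodSet_everyMember)
    (hBI : Beauville1983_hilbertSquare_markedIncidence) (hBea : Beauville1983_hilbertSquare_blowupDiagonal_surjection)
    (hMk : Markman2024_rationalHodgeIsometry_lift_algebraic_marked) (hcup : Voisin2003_cupProduct_algebraicClasses)
    {g : Module.End ℂ (K3Index → ℂ)} {u₁ u₂ : K3Index → ℤ} {y₀ : K3Index → ℂ} {θ : Matrix K3Index K3Index ℚ}
    (hZ : Zeta11Model[g, u₁, u₂, y₀, θ])
    (hX : IsSmoothProjective 4 X) (hK : IsOfK3HilbertSquareType X) (hM : MarkedK3Sq[X, φ, P, z])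
    (hS : IsK3Surface S) (hMS : MarkedK3[S, η, p, x])
    {g' : complexBetti S (2 * 1) →ₗ[ℂ] complexBetti X 2} (hg : Partner[X, φ, S, η, g'])
    (σ : Module.End ℂ (K3Index → ℂ)) (hσ : ∀ a b, k3Form (σ a) (σ b) = k3Form a b)
    (hσrat : ∀ v : K3Index → ℤ, ∃ w : K3Index → ℚ, σ (fun i => (v i : ℂ)) = fun i => (w i : ℂ))
    (heig : thetaC θ (σ x) = (((2 * Real.cos (2 * Real.pi / 11) : ℝ)) : ℂ) • σ x) :
    HodgeConjectureFor 4 X := by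
  have hSS := hodgeConjectureFor_square_of_zeta11Locus hB hmark hV hZ S hS η p x hMS σ hσ hσrat heig
  obtain ⟨_, hmk, hxx, hxpos, hu⟩ := hMS
  obtain ⟨hg1, hg2, hg5⟩ := hg
  exact partnerTransport_explicit hBI hBea hMk hcup hX hK hM hS hmk hxx hxpos hu hg1 hg2 hg5 hSS

end Summit.HodgeConjecture.HodgeConjecture.Theorems.MarkmanPartnerTransport.PartnerLattice

end
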